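import Mathlib
import Literature.Analysis.Calculus.BorelCutoffSeriesBanach
import Literature.Analysis.Calculus.TaylorValueFlatParam
import HarnessLib

/-!
# Borel's lemma in two variables with parameters (Banach-valued): prescribed nested jets, prescribed Taylor polynomials

Topic `Analysis/Calculus`; namespace `Literature.Analysis.Calculus`.  THEOREMS ONLY (no `def`, no instance, no notation, no named
fact, no `sorry`); imports ★ `BorelCutoffSeriesBanach` (LH7-p04 (g7), p851727: É. Borel's theorem with parameters, one variable,
Banach-valued — Hörmander's cut-off series [HormanderALPDO1, §1.2 Thm. 1.2.6]) and ★ `TaylorValueFlatParam` (p851735: the value-flat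
Taylor currency).  Brick B2′ «FILE B» of the GLAESER–CHEVALLEY `S₃` road G″ (cell `pub/hodgecm-mathlib`, N8-census §5 (9), LEAD T13-42
priority (5); binder LH7-p01 (g6); pen F0P2-p02 (g20)); consumed by brick B1 «formal part at the corner» (`brick_formal`).

THE MATHEMATICS (variables first, parameter `z : P` last; `P` finite-dimensional, `E` complete).  Given smooth coefficient functions
`c i j : P → E` (`i, j ∈ ℕ`):
* (B2′-jet) `exists_contDiff_nestedJet_eq`: there is a smooth `G : ℝ × ℝ × P → E` with ALL nested jets along the section `u = v = 0`
  prescribed, `∂ᵤⁱ ∂ᵥʲ G(0, 0, z) = c i j z` — written `iteratedDeriv i (fun u ↦ iteratedDeriv j (fun v ↦ G (u, v, z)) 0) 0` (★ `NestedJets`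
  shape).  PROOF: Hörmander's one-variable Borel theorem with parameters TWICE — first in `u` with parameter `z` for each column
  `(c i j)_i` (★ (H5) `exists_contDiff_iteratedDeriv_zeroSection_eq_of_finiteDimensional`, support-free because `P` is finite-dimensional),
  giving smooth `g j : ℝ × P → E` with `∂ᵤⁱ g j (0, z) = c i j z`; then in `v` with the finite-dimensional parameter `(u, z) : ℝ × P` and
  coefficients `g j`, giving `W` with `∂ᵥʲ W(0, (u, z)) = g j (u, z)` for ALL `(u, z)`; `G (u, v, z) := W (v, (u, z))`.  Differentiating the
  section identity in `u` (it holds identically in `u`) yields the nested jets.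
* (B2′) `exists_contDiff_isBigO_sub_taylorSum₂`: the same `G` has the prescribed TAYLOR POLYNOMIALS in value-flat currency,
  `G(u, v, z) − Σ_{i ≤ N} Σ_{j ≤ N} (uⁱ vʲ / (i! j!)) • c i j z = O(‖(u, v)‖^{N+1})` as `(u, v, z) → (0, 0, z₀)`, for every `z₀` and `N`
  (★ `TaylorValueFlatParam.isBigO_sub_taylorSum₂` with the jets rewritten); triangular truncation `i + j ≤ N` in
  `exists_contDiff_isBigO_sub_taylorSum₂_triangular`; and the `brick_formal`-shaped exponent `‖(u, v)‖ ^ N` in `…_pow`.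
HONEST LABEL: count-neutral Mathlib-side analysis; HC_CM is proved only modulo the printed citations (hLiu418 = `stmt-HodgeConjecture-24832`,
h413 = `stmt-HodgeConjecture-24833`) until rung 0 closes.

## References
* [HormanderALPDO1] L. Hörmander, *The Analysis of Linear Partial Differential Operators I* (1983; Classics ed. 2003, same numbering),
  §1.2 Thm. 1.2.6 p. 16 (É. Borel's theorem with parameters, cut-off series (1.2.4)); §1.1 Taylor's formula (1.1.7)–(1.1.8) pp. 12–13.
  The two-variable statement is Thm. 1.2.6 applied twice (Hörmander states it for `x ∈ ℝⁿ` and `t ∈ ℝ` with all `∂ₜʲ u(t, x)|_{t=0}`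
  prescribed; iterating in the second variable with the first adjoined to the parameters gives the full two-variable jet).
-/

noncomputable section

open Set Filter Topology Asymptotics Finset Metric
open scoped ContDiff Nat

namespace Literature.Analysis.Calculus

variable {P : Type*} [NormedAddCommGroup P] [NormedSpace ℝ P] [FiniteDimensional ℝ P]
  {E : Type*} [NormedAddCommGroup E] [NormedSpace ℝ E] [CompleteSpace E]

/-- (B2′-jet) **Borel's lemma in two variables with parameters, nested-jet form.**  For smooth `c i j : P → E` there is a smooth
`G : ℝ × ℝ × P → E` with `∂ᵤⁱ ∂ᵥʲ G(0, 0, z) = c i j z` for all `i j z`, the mixed partials written as NESTED one-variable jets.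
(Hörmander's Thm. 1.2.6 twice: in `u` with parameter `z`, then in `v` with parameter `(u, z)`.)
[cite: HormanderALPDO1, §1.2 Thm. 1.2.6 (p. 16)] -/
theorem exists_contDiff_nestedJet_eq (c : ℕ → ℕ → P → E) (hc : ∀ i j, ContDiff ℝ ∞ (c i j)) :
    ∃ G : ℝ × ℝ × P → E, ContDiff ℝ ∞ G ∧
      ∀ (z : P) (i j : ℕ), iteratedDeriv i (fun u => iteratedDeriv j (fun v => G (u, v, z)) 0) 0 = c i j z := by
  -- step 1: for each `j`, Borel in `u` with parameter `z` for the column `i ↦ c i j`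
  have h1 : ∀ j : ℕ, ∃ g : ℝ × P → E, ContDiff ℝ ∞ g ∧
      ∀ (z : P) (i : ℕ), iteratedDeriv i (fun u => g (u, z)) 0 = c i j z :=
    fun j => exists_contDiff_iteratedDeriv_zeroSection_eq_of_finiteDimensional (fun i => c i j) (fun i => hc i j)
  choose g hg hgc using h1
  -- step 2: Borel in `v` with the finite-dimensional parameter `(u, z) : ℝ × P` and coefficients `g j`
  obtain ⟨W, hW, hWj⟩ := exists_contDiff_iteratedDeriv_zeroSection_eq_of_finiteDimensional (P := ℝ × P) g hg
  refine ⟨fun q => W (q.2.1, (q.1, q.2.2)), ?_, ?_⟩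
  · exact hW.comp ((contDiff_fst.comp contDiff_snd).prodMk (contDiff_fst.prodMk (contDiff_snd.comp contDiff_snd)))
  · intro z i j
    show iteratedDeriv i (fun u => iteratedDeriv j (fun v => W (v, (u, z))) 0) 0 = c i j z
    have hfun : (fun u => iteratedDeriv j (fun v => W (v, (u, z))) 0) = fun u => g j (u, z) :=
      funext fun u => hWj (u, z) j
    rw [hfun]
    exact hgc j z i

/-- (B2′) **Borel's lemma in two variables with parameters, prescribed Taylor polynomials in value-flat currency** (the head brick B1
of the Glaeser road consumes).  For smooth `c i j : P → E` there is a smooth `G : ℝ × ℝ × P → E` with nested jets `c i j z` along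
`u = v = 0` AND, for every `z₀ : P` and `N : ℕ`,
`G(u, v, z) − Σ_{i ≤ N} Σ_{j ≤ N} (uⁱ vʲ / (i! j!)) • c i j z = O(‖(u, v)‖^{N+1})` as `(u, v, z) → (0, 0, z₀)`.
[cite: HormanderALPDO1, §1.2 Thm. 1.2.6 (p. 16); §1.1 (1.1.7)′–(1.1.8) pp. 12–13] -/
theorem exists_contDiff_isBigO_sub_taylorSum₂ (c : ℕ → ℕ → P → E) (hc : ∀ i j, ContDiff ℝ ∞ (c i j)) :
    ∃ G : ℝ × ℝ × P → E, ContDiff ℝ ∞ G ∧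
      (∀ (z : P) (i j : ℕ), iteratedDeriv i (fun u => iteratedDeriv j (fun v => G (u, v, z)) 0) 0 = c i j z) ∧
      ∀ (z₀ : P) (N : ℕ), (fun q : ℝ × ℝ × P => G q - ∑ i ∈ Finset.range (N + 1), ∑ j ∈ Finset.range (N + 1),
          (q.1 ^ i * q.2.1 ^ j / ((i ! : ℝ) * j !)) • c i j q.2.2)
        =O[𝓝 ((0, 0, z₀) : ℝ × ℝ × P)] fun q => ‖(q.1, q.2.1)‖ ^ (N + 1) := by
  obtain ⟨G, hG, hjet⟩ := exists_contDiff_nestedJet_eq c hc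
  refine ⟨G, hG, hjet, fun z₀ N => ?_⟩
  refine (isBigO_sub_taylorSum₂ G hG z₀ N).congr_left fun q => ?_
  simp only [hjet]

/-- (B2″) The same with the total-degree truncation `i + j ≤ N`.
[cite: HormanderALPDO1, §1.2 Thm. 1.2.6 (p. 16); §1.1 (1.1.7)′–(1.1.8) pp. 12–13] -/
theorem exists_contDiff_isBigO_sub_taylorSum₂_triangular (c : ℕ → ℕ → P → E) (hc : ∀ i j, ContDiff ℝ ∞ (c i j)) :
    ∃ G : ℝ × ℝ × P → E, ContDiff ℝ ∞ G ∧
      (∀ (z : P) (i j : ℕ), iteratedDeriv i (fun u => iteratedDeriv j (fun v => G (u, v, z)) 0) 0 = c i j z) ∧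
      ∀ (z₀ : P) (N : ℕ), (fun q : ℝ × ℝ × P => G q - ∑ i ∈ Finset.range (N + 1), ∑ j ∈ Finset.range (N + 1 - i),
          (q.1 ^ i * q.2.1 ^ j / ((i ! : ℝ) * j !)) • c i j q.2.2)
        =O[𝓝 ((0, 0, z₀) : ℝ × ℝ × P)] fun q => ‖(q.1, q.2.1)‖ ^ (N + 1) := by
  obtain ⟨G, hG, hjet⟩ := exists_contDiff_nestedJet_eq c hc
  refine ⟨G, hG, hjet, fun z₀ N => ?_⟩
  refine (isBigO_sub_taylorSum₂_triangular G hG z₀ N).congr_left fun q => ?_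
  simp only [hjet]

/-- (B2′, `brick_formal` exponent) The value-flat conclusion with exponent `N` (from `N + 1 ≥ N` near the base point): for every
`z₀` and `N`, `G − (Taylor polynomial of bidegree ≤ (N, N)) = O(‖(u, v)‖ ^ N)`.
[cite: HormanderALPDO1, §1.2 Thm. 1.2.6 (p. 16); §1.1 (1.1.7)′–(1.1.8) pp. 12–13] -/
theorem exists_contDiff_isBigO_sub_taylorSum₂_pow (c : ℕ → ℕ → P → E) (hc : ∀ i j, ContDiff ℝ ∞ (c i j)) :
    ∃ G : ℝ × ℝ × P → E, ContDiff ℝ ∞ G ∧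
      (∀ (z : P) (i j : ℕ), iteratedDeriv i (fun u => iteratedDeriv j (fun v => G (u, v, z)) 0) 0 = c i j z) ∧
      ∀ (z₀ : P) (N : ℕ), (fun q : ℝ × ℝ × P => G q - ∑ i ∈ Finset.range (N + 1), ∑ j ∈ Finset.range (N + 1),
          (q.1 ^ i * q.2.1 ^ j / ((i ! : ℝ) * j !)) • c i j q.2.2)
        =O[𝓝 ((0, 0, z₀) : ℝ × ℝ × P)] fun q => ‖(q.1, q.2.1)‖ ^ N := by
  obtain ⟨G, hG, hjet, hO⟩ := exists_contDiff_isBigO_sub_taylorSum₂ c hc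
  exact ⟨G, hG, hjet, fun z₀ N => (hO z₀ N).trans (isBigO_norm_pow_of_le z₀ (Nat.le_succ N))⟩

end Literature.Analysis.Calculus
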